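import Mathlib
import Literature.LinearAlgebra.Matrix.GramDeterminantKernel
import HarnessLib

/-!
# A linear independence criterion from vectors of type II approximations (Marcovecchio 2021, Thms 2.1–2.3)

Topic `Literature/NumberTheory/DiophantineApproximation`. Source: R. Marcovecchio, *Vectors of type II Hermite–Padé
approximations and a new linear independence criterion*, Ann. Mat. Pura Appl. (4) **200** (2021) 2829–2861 =
arXiv:2006.11260 [Marcovecchio2021], §2.1. READ ON THE PAGE (held text `paper:arxiv-2006.11260`, chunk p0005):

"Let `γ_1, …, γ_m` be real numbers, and let `l ∈ {1, …, m}`. Let also `q_n^{(ν)}, p_n^{(1,ν)}, …, p_n^{(m,ν)}`, with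
`ν = 1, …, l`, be `l(m+1)` sequences of integers, and put (2.1) `ε_n^{(μ,ν)} := q_n^{(ν)} γ_μ − p_n^{(μ,ν)}`
(`μ = 1, …, m`; `ν = 1, …, l`). **Theorem 2.1.** Suppose that for all choices of `l` (distinct) indices
`μ = (μ_1, …, μ_l)` from `1` to `m`, `det[ε_n^{(μ_i,ν)}]_{i,ν=1..l} → 0` (`n → ∞`). Furthermore, suppose that for
all `λ^{(i,j)} ∈ ℤ` (`i = 1..l`, `j = 1..m`) such that the matrix `λ = [λ^{(i,j)}]` has rank `l`, the square matrix
`λ ε_n` is non-singular for infinitely many `n`. Then `dim_ℚ(ℚ + ℚγ_1 + ⋯ + ℚγ_m) ≥ 2 + m − l`."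

("a dual version of the standard linear independence criterion", Abstract; `l = 1` is the folklore type II
criterion.) The printed proof (half a page: `l` independent integer relations `ϖ + ωγ = 0` would make `ωε_n` an
integer matrix, non-singular infinitely often, while Binet–Cauchy and the hypothesis force `det(ωε_n) → 0`) is
FORMALISED here: `theorem21_holds`; likewise **Theorem 2.2** ("By repeating the same proof", the non-singularity
hypothesis on the integer matrices `θq_n + λp_n`): `theorem22`, `theorem22_holds`; and **Theorem 2.3** (§2.3 "second
variation", p0006: `(m+1)²` sequences `q_n^{(ν)}, p_n^{(μ,ν)}`, `ν = 0, …, m`; minors `det ε_n^{(μ,ν)} → 0` and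
`det[q_n; p_n] ≠ 0` for all `n` — proof by rank + pigeonhole + Binet–Cauchy): `theorem23`, `theorem23_holds`.
Rendering: indices `Fin m`, `Fin l` (`Fin (m+1)` for `ν = 0..m`); "rank `l`" for an integer `l × m` matrix = its rows
are linearly independent (over `ℤ`, equivalently over `ℚ`); the hypothesis on `det ε^{(μ,−)}` is asked for every
injective `μ : Fin l → Fin m` (equivalent to the increasing choices up to sign); Binet–Cauchy is the tree's
`Literature.LinearAlgebra.Matrix.det_mul_eq_sum_pi'`.

NOT typed: Theorem 2.4 (the refinement with denominator sequences `D_n^{(μ)}`, `δ_n^{(ν)}` and rational `q̂, p̂`; by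
Remark 2.5 "equivalent to its special case where `δ_n^{ν} = 1`"), §3 (Sylvester–Franke, Pituk), §4 (the outlined
applications to `1, Li₁(1/q), Li₂(1/q), Li₁(2/q), Li₂(2/q)` — heuristic in print). WHAT THIS IS NOT: nothing about
`ζ(5)`; criteria for simultaneous (type II) approximations, PROVED.
-/

noncomputable section

open Filter Topology Finset Matrix

namespace Literature.NumberTheory.DiophantineApproximation.Marcovecchio2021

/-- The approximation errors (2.1): `ε_n^{(μ,ν)} = q_n^{(ν)} γ_μ − p_n^{(μ,ν)}`, as an `m × l` real matrix.
[cite: Marcovecchio2021, §2.1 eq. (2.1)] -/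
def eps {m l : ℕ} (γ : Fin m → ℝ) (q : ℕ → Fin l → ℤ) (p : ℕ → Fin m → Fin l → ℤ) (n : ℕ) :
    Matrix (Fin m) (Fin l) ℝ :=
  fun μ ν => (q n ν : ℝ) * γ μ - p n μ ν

/-- **Theorem 2.1** (Marcovecchio 2021), as printed (see the module docstring): if every `l × l` minor
`det ε_n^{(μ,−)}` built on `l` distinct rows tends to `0` and, for every integer `l × m` matrix `λ` of rank `l`,
`λ ε_n` is non-singular for infinitely many `n`, then `dim_ℚ(ℚ + ℚγ_1 + ⋯ + ℚγ_m) ≥ 2 + m − l`.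
[cite: Marcovecchio2021, Theorem 2.1] -/
def theorem21 : Prop :=
  ∀ (m l : ℕ) (γ : Fin m → ℝ) (q : ℕ → Fin l → ℤ) (p : ℕ → Fin m → Fin l → ℤ),
    1 ≤ l → l ≤ m →
    (∀ μ : Fin l → Fin m, Function.Injective μ →
        Tendsto (fun n => ((eps γ q p n).submatrix μ id).det) atTop (𝓝 0)) →
    (∀ Λ : Matrix (Fin l) (Fin m) ℤ, LinearIndependent ℤ (fun i => Λ i) →
        {n : ℕ | ((Λ.map (Int.cast : ℤ → ℝ)) * eps γ q p n).det ≠ 0}.Infinite) →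
    m + 2 - l ≤ Module.finrank ℚ ↥(Submodule.span ℚ (insert (1 : ℝ) (Set.range γ)))

/-! ### Proof -/

/-- Binet–Cauchy step: if all `l × l` minors of `E_n` on distinct rows tend to `0`, then `det(A E_n) → 0` for every
constant `l × m` matrix `A`. [cite: Marcovecchio2021, Theorem 2.1 (proof, Binet–Cauchy)] -/
theorem tendsto_det_mul {m l : ℕ} (A : Matrix (Fin l) (Fin m) ℝ) (E : ℕ → Matrix (Fin m) (Fin l) ℝ)
    (hE : ∀ μ : Fin l → Fin m, Function.Injective μ →
      Tendsto (fun n => ((E n).submatrix μ id).det) atTop (𝓝 0)) :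
    Tendsto (fun n => (A * E n).det) atTop (𝓝 0) := by
  have hexp : ∀ n, (A * E n).det =
      ∑ μ : Fin l → Fin m, (∏ i, A i (μ i)) * ((E n).submatrix μ id).det := by
    intro n
    rw [← det_transpose, transpose_mul, Literature.LinearAlgebra.Matrix.det_mul_eq_sum_pi']
    refine sum_congr rfl fun μ _ => ?_
    congr 1
    rw [← det_transpose]
    rfl
  simp_rw [hexp]
  have h0 : (0 : ℝ) = ∑ μ : Fin l → Fin m, (∏ i, A i (μ i)) * 0 := by simp
  rw [h0]
  refine tendsto_finsetSum _ fun μ _ => Tendsto.const_mul _ ?_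
  by_cases hμ : Function.Injective μ
  · exact hE μ hμ
  · have hdet : ∀ n, ((E n).submatrix μ id).det = 0 := by
      intro n
      obtain ⟨i, j, hij, hne⟩ : ∃ i j, μ i = μ j ∧ i ≠ j := by
        simpa [Function.Injective] using hμ
      exact det_zero_of_row_eq hne (by ext ν; simp [submatrix_apply, hij])
    simp_rw [hdet]
    exact tendsto_const_nhds

/-- **Theorem 2.2** (Marcovecchio 2021; "By repeating the same proof as in Theorem 2.1"): the same conclusion when
the non-singularity hypothesis is put on the INTEGER matrices `θ q_n + λ p_n` for every integer `l × (m+1)` matrix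
`[θ | λ]` of rank `l`. [cite: Marcovecchio2021, Theorem 2.2] -/
def theorem22 : Prop :=
  ∀ (m l : ℕ) (γ : Fin m → ℝ) (q : ℕ → Fin l → ℤ) (p : ℕ → Fin m → Fin l → ℤ),
    1 ≤ l → l ≤ m →
    (∀ μ : Fin l → Fin m, Function.Injective μ →
        Tendsto (fun n => ((eps γ q p n).submatrix μ id).det) atTop (𝓝 0)) →
    (∀ (θ : Fin l → ℤ) (Λ : Matrix (Fin l) (Fin m) ℤ),
        LinearIndependent ℤ (fun i => (Fin.cons (θ i) (Λ i) : Fin (m + 1) → ℤ)) →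
        {n : ℕ | (Matrix.of (fun i ν => θ i * q n ν + ∑ μ, Λ i μ * p n μ ν)).det ≠ 0}.Infinite) →
    m + 2 - l ≤ Module.finrank ℚ ↥(Submodule.span ℚ (insert (1 : ℝ) (Set.range γ)))

/-- Clearing denominators: for finitely many rationals there is a positive integer `D` with all `D·v_i ∈ ℤ`.
[folklore] -/
private theorem exists_common_den {ι : Type*} [Fintype ι] (v : ι → ℚ) :
    ∃ D : ℕ, 0 < D ∧ ∀ i, ∃ z : ℤ, (D : ℚ) * v i = z := by
  refine ⟨∏ i, (v i).den, Finset.prod_pos fun i _ => (v i).den_pos, fun i => ?_⟩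
  obtain ⟨c, hc⟩ : (v i).den ∣ ∏ j, (v j).den := Finset.dvd_prod_of_mem _ (mem_univ i)
  refine ⟨c * (v i).num, ?_⟩
  rw [hc]
  push_cast
  have hden : ((v i).den : ℚ) ≠ 0 := by exact_mod_cast (v i).den_ne_zero
  calc ((v i).den : ℚ) * c * v i = c * (v i * (v i).den) := by ring
    _ = c * (v i).num := by rw [Rat.mul_den_eq_num]

/-- The common first step of the proofs of Theorems 2.1 and 2.2: if `dim_ℚ(ℚ + ℚγ_1 + ⋯ + ℚγ_m) ≤ 1 + m − l`, there
are `l` integer relations `z_{i,0} + Σ_μ z_{i,μ+1} γ_μ = 0` whose coefficient vectors are linearly independent.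
[cite: Marcovecchio2021, Theorem 2.1 (proof, first paragraph)] -/
theorem exists_integer_relations {m l : ℕ} (γ : Fin m → ℝ)
    (hlt : Module.finrank ℚ ↥(Submodule.span ℚ (insert (1 : ℝ) (Set.range γ))) < m + 2 - l) :
    ∃ z : Fin l → Fin (m + 1) → ℤ, LinearIndependent ℤ z ∧
      ∀ i, (z i 0 : ℝ) + ∑ μ, (z i μ.succ : ℝ) * γ μ = 0 := by
  set g : Fin (m + 1) → ℝ := Fin.cons 1 γ with hg
  set Φ : (Fin (m + 1) → ℚ) →ₗ[ℚ] ℝ := Fintype.linearCombination ℚ g with hΦ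
  have hrange : LinearMap.range Φ = Submodule.span ℚ (insert (1 : ℝ) (Set.range γ)) := by
    rw [hΦ, Fintype.range_linearCombination, hg, Fin.range_cons]
  have hrn := LinearMap.finrank_range_add_finrank_ker Φ
  rw [hrange, Module.finrank_fin_fun] at hrn
  have hker : l ≤ Module.finrank ℚ ↥(LinearMap.ker Φ) := by omega
  set B := Module.finBasis ℚ ↥(LinearMap.ker Φ) with hB
  set v : Fin l → Fin (m + 1) → ℚ :=
    fun i => ((B (Fin.castLE hker i) : ↥(LinearMap.ker Φ)) : Fin (m + 1) → ℚ) with hv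
  have hvker : ∀ i, Φ (v i) = 0 := fun i => LinearMap.mem_ker.mp (B (Fin.castLE hker i)).2
  have hvli : LinearIndependent ℚ v := by
    have h1 : LinearIndependent ℚ (fun i : Fin l => B (Fin.castLE hker i)) :=
      B.linearIndependent.comp _ (Fin.castLE_injective hker)
    exact h1.map' (LinearMap.ker Φ).subtype (Submodule.ker_subtype _)
  obtain ⟨D, hDpos, hD⟩ := exists_common_den (fun ij : Fin l × Fin (m + 1) => v ij.1 ij.2)
  choose zf hzf using hD
  set z : Fin l → Fin (m + 1) → ℤ := fun i j => zf (i, j) with hz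
  have hzv : ∀ i j, ((z i j : ℤ) : ℚ) = (D : ℚ) * v i j := fun i j => (hzf (i, j)).symm
  refine ⟨z, ?_, ?_⟩
  · -- independence over `ℤ` from the independence of `v` over `ℚ`
    rw [Fintype.linearIndependent_iff]
    intro c hc i
    have hall : ∀ k : Fin (m + 1), ∑ j, c j * z j k = 0 := by
      intro k
      have := congr_fun hc k
      simpa [Finset.sum_apply, Pi.smul_apply, smul_eq_mul] using this
    have hvq : ∑ j, ((c j : ℚ) * D) • v j = 0 := by
      ext k
      simp only [Finset.sum_apply, Pi.smul_apply, smul_eq_mul, Pi.zero_apply]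
      have := hall k
      have h2 : ∑ j, (c j : ℚ) * ((z j k : ℤ) : ℚ) = 0 := by exact_mod_cast this
      simp_rw [hzv] at h2
      simpa [mul_assoc, mul_left_comm] using h2
    have := (Fintype.linearIndependent_iff.mp hvli) (fun j => (c j : ℚ) * D) hvq i
    have hD0 : (D : ℚ) ≠ 0 := by exact_mod_cast hDpos.ne'
    simpa [hD0] using this
  · intro i
    have h0 := hvker i
    rw [hΦ, Fintype.linearCombination_apply, Fin.sum_univ_succ] at h0
    simp only [hg, Fin.cons_zero, Fin.cons_succ] at h0
    have h1 : ∀ j, (z i j : ℝ) = (D : ℝ) * ((v i j : ℚ) : ℝ) := by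
      intro j
      have := hzv i j
      have : ((z i j : ℚ) : ℝ) = (((D : ℚ) * v i j : ℚ) : ℝ) := by rw [this]
      push_cast at this ⊢
      exact this
    simp_rw [h1]
    have : (D : ℝ) * (v i 0 • (1 : ℝ) + ∑ μ : Fin m, v i μ.succ • γ μ) = 0 := by rw [h0, mul_zero]
    simpa [Rat.smul_def, mul_add, mul_sum, mul_assoc, mul_left_comm] using this

/-- With integer relations `z` as above, `ω := (z_{i,μ+1})` satisfies `ω ε_n = −(ϖ q_n + ω p_n)` (`ϖ_i = z_{i,0}`), an
integer matrix (`l` relations, `k` columns: `k = l` in Theorems 2.1–2.2, `k = m + 1` in Theorem 2.3).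
[cite: Marcovecchio2021, Theorem 2.1 (proof, display "ω ε_n = −[ϖ | ω][q_n; p_n]") and Theorem 2.3 (proof)] -/
theorem omega_mul_eps {m l k : ℕ} (γ : Fin m → ℝ) (q : ℕ → Fin k → ℤ) (p : ℕ → Fin m → Fin k → ℤ)
    (z : Fin l → Fin (m + 1) → ℤ) (hrel : ∀ i, (z i 0 : ℝ) + ∑ μ, (z i μ.succ : ℝ) * γ μ = 0) (n : ℕ) :
    ((Matrix.of fun i μ => z i μ.succ : Matrix (Fin l) (Fin m) ℤ).map (Int.cast : ℤ → ℝ)) * eps γ q p n =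
      (Matrix.of fun i ν => -(z i 0 * q n ν + ∑ μ, z i μ.succ * p n μ ν)).map (Int.cast : ℤ → ℝ) := by
  ext i ν
  simp only [mul_apply, map_apply, eps, of_apply]
  push_cast
  have : ∑ μ, (z i μ.succ : ℝ) * ((q n ν : ℝ) * γ μ - p n μ ν) =
      (q n ν : ℝ) * ∑ μ, (z i μ.succ : ℝ) * γ μ - ∑ μ, (z i μ.succ : ℝ) * p n μ ν := by
    simp_rw [mul_sub, sum_sub_distrib, mul_sum]
    refine congrArg₂ _ (sum_congr rfl fun μ _ => ?_) rfl
    ring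
  rw [this, eq_neg_of_add_eq_zero_right (hrel i)]
  ring

/-- **Theorem 2.1 holds** (the printed proof, formalised). [cite: Marcovecchio2021, Theorem 2.1] -/
theorem theorem21_holds : theorem21 := by
  intro m l γ q p hl hlm hdet hnonsing
  by_contra hlt
  rw [not_le] at hlt
  obtain ⟨z, hzli, hrel⟩ := exists_integer_relations γ hlt
  set ω : Matrix (Fin l) (Fin m) ℤ := Matrix.of fun i μ => z i μ.succ with hω
  -- `ω` has independent rows: a combination killing the `γ`-parts kills the constant parts too
  have hωli : LinearIndependent ℤ (fun i => ω i) := by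
    rw [Fintype.linearIndependent_iff]
    intro c hc i
    have hcω : ∀ μ : Fin m, ∑ j, c j * z j μ.succ = 0 := by
      intro μ
      have := congr_fun hc μ
      simpa [hω, Finset.sum_apply, Pi.smul_apply, smul_eq_mul] using this
    have hc0 : ∑ j, (c j : ℝ) * z j 0 = 0 := by
      have : ∑ j, (c j : ℝ) * z j 0 = ∑ j, (c j : ℝ) * (-(∑ μ, (z j μ.succ : ℝ) * γ μ)) := by
        refine sum_congr rfl fun j _ => ?_
        rw [eq_neg_of_add_eq_zero_left (hrel j)]
      rw [this]
      have hswap : ∑ j, (c j : ℝ) * (-(∑ μ, (z j μ.succ : ℝ) * γ μ)) =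
          -∑ μ : Fin m, (∑ j, (c j : ℝ) * z j μ.succ) * γ μ := by
        simp_rw [mul_neg, sum_neg_distrib, mul_sum, sum_mul]
        rw [sum_comm]
        refine congrArg _ (sum_congr rfl fun μ _ => sum_congr rfl fun j _ => by ring)
      rw [hswap]
      have : ∀ μ : Fin m, (∑ j, (c j : ℝ) * z j μ.succ) = 0 := by
        intro μ
        have := hcω μ
        exact_mod_cast this
      simp [this]
    have hc0' : ∑ j, c j * z j 0 = 0 := by exact_mod_cast hc0
    have hall : ∑ j, c j • z j = 0 := by
      ext k
      simp only [Finset.sum_apply, Pi.smul_apply, smul_eq_mul, Pi.zero_apply]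
      exact Fin.cases hc0' (fun μ => hcω μ) k
    exact (Fintype.linearIndependent_iff.mp hzli) c hall i
  have hωε := omega_mul_eps γ q p z hrel
  set N : ℕ → Matrix (Fin l) (Fin l) ℤ :=
    fun n => Matrix.of fun i ν => -(z i 0 * q n ν + ∑ μ, z i μ.succ * p n μ ν) with hN
  have hinf := hnonsing ω hωli
  have hfreq : ∃ᶠ n in atTop, (1 : ℝ) ≤ |((ω.map (Int.cast : ℤ → ℝ)) * eps γ q p n).det| := by
    refine (Nat.frequently_atTop_iff_infinite.mpr hinf).mono fun n hn => ?_
    rw [hω, hωε n, ← Int.cast_det] at hn ⊢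
    have h1 : (1 : ℤ) ≤ |(N n).det| := Int.one_le_abs (by exact_mod_cast hn)
    exact_mod_cast h1
  have hlim := tendsto_det_mul (ω.map (Int.cast : ℤ → ℝ)) (eps γ q p) hdet
  have hev : ∀ᶠ n in atTop, |((ω.map (Int.cast : ℤ → ℝ)) * eps γ q p n).det| < 1 :=
    (hlim.abs).eventually (gt_mem_nhds (by norm_num : |(0 : ℝ)| < 1))
  obtain ⟨n, hn1, hn2⟩ := (hfreq.and_eventually hev).exists
  linarith

/-- **Theorem 2.2 holds** (same proof: now the non-singularity hypothesis is used on the integer matrix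
`ϖ q_n + ω p_n = −ω ε_n`). [cite: Marcovecchio2021, Theorem 2.2] -/
theorem theorem22_holds : theorem22 := by
  intro m l γ q p hl hlm hdet hnonsing
  by_contra hlt
  rw [not_le] at hlt
  obtain ⟨z, hzli, hrel⟩ := exists_integer_relations γ hlt
  set ω : Matrix (Fin l) (Fin m) ℤ := Matrix.of fun i μ => z i μ.succ with hω
  have hωε := omega_mul_eps γ q p z hrel
  -- `[ϖ | ω] = z` has rank `l`
  have hzli' : LinearIndependent ℤ (fun i => (Fin.cons (z i 0) (ω i) : Fin (m + 1) → ℤ)) := by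
    have : (fun i => (Fin.cons (z i 0) (ω i) : Fin (m + 1) → ℤ)) = z := by
      funext i
      ext k
      refine Fin.cases ?_ (fun μ => ?_) k
      · simp
      · simp [hω]
    rw [this]
    exact hzli
  have hinf := hnonsing (fun i => z i 0) ω hzli'
  set M : ℕ → Matrix (Fin l) (Fin l) ℤ :=
    fun n => Matrix.of fun i ν => z i 0 * q n ν + ∑ μ, ω i μ * p n μ ν with hM
  have hN : ∀ n, (Matrix.of fun i ν => -(z i 0 * q n ν + ∑ μ, z i μ.succ * p n μ ν) :
      Matrix (Fin l) (Fin l) ℤ) = -M n := by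
    intro n
    ext i ν
    simp [hM, hω]
  have hfreq : ∃ᶠ n in atTop, (1 : ℝ) ≤ |((ω.map (Int.cast : ℤ → ℝ)) * eps γ q p n).det| := by
    refine (Nat.frequently_atTop_iff_infinite.mpr hinf).mono fun n hn => ?_
    have hn' : (M n).det ≠ 0 := by simpa [hM] using hn
    rw [hω, hωε n, hN n, ← Int.cast_det, det_neg]
    have h1 : (1 : ℤ) ≤ |(M n).det| := Int.one_le_abs hn'
    have h2 : (1 : ℝ) ≤ |((M n).det : ℝ)| := by exact_mod_cast h1
    simpa [abs_mul, abs_pow] using h2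
  have hlim := tendsto_det_mul (ω.map (Int.cast : ℤ → ℝ)) (eps γ q p) hdet
  have hev : ∀ᶠ n in atTop, |((ω.map (Int.cast : ℤ → ℝ)) * eps γ q p n).det| < 1 :=
    (hlim.abs).eventually (gt_mem_nhds (by norm_num : |(0 : ℝ)| < 1))
  obtain ⟨n, hn1, hn2⟩ := (hfreq.and_eventually hev).exists
  linarith

/-! ### Second variation (§2.3): `(m+1)²` sequences — Theorem 2.3 -/

/-- **Theorem 2.3** (Marcovecchio 2021, "second variation"): now `q_n^{(ν)}, p_n^{(μ,ν)}` (`μ = 1, …, m`,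
`ν = 0, …, m`) are `(m+1)²` integer sequences and `ε_n^{(μ,ν)} = q_n^{(ν)} γ_μ − p_n^{(μ,ν)}`; if every `l × l` minor
`det ε_n^{(μ,ν)}` (distinct rows `μ`, distinct columns `ν`) tends to `0` and the `(m+1) × (m+1)` integer matrix
`[q_n; p_n]` (first row `q_n`, then the rows `p_n^{(μ,·)}`) is non-singular for every `n = 0, 1, 2, …`, then
`dim_ℚ(ℚ + ℚγ_1 + ⋯ + ℚγ_m) ≥ 2 + m − l`. [cite: Marcovecchio2021, Theorem 2.3] -/
def theorem23 : Prop :=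
  ∀ (m l : ℕ) (γ : Fin m → ℝ) (q : ℕ → Fin (m + 1) → ℤ) (p : ℕ → Fin m → Fin (m + 1) → ℤ),
    1 ≤ l → l ≤ m →
    (∀ (μ : Fin l → Fin m) (ν : Fin l → Fin (m + 1)), Function.Injective μ → Function.Injective ν →
        Tendsto (fun n => ((eps γ q p n).submatrix μ ν).det) atTop (𝓝 0)) →
    (∀ n : ℕ, (Matrix.of (Fin.cons (q n) (p n) : Fin (m + 1) → Fin (m + 1) → ℤ)).det ≠ 0) →
    m + 2 - l ≤ Module.finrank ℚ ↥(Submodule.span ℚ (insert (1 : ℝ) (Set.range γ)))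

/-- Integer vectors independent over `ℤ` stay independent over `ℚ` (clear denominators). [folklore] -/
private theorem linearIndependent_cast_rat {l k : ℕ} (z : Fin l → Fin k → ℤ) (hz : LinearIndependent ℤ z) :
    LinearIndependent ℚ (fun i j => (z i j : ℚ)) := by
  rw [Fintype.linearIndependent_iff]
  intro c hc i
  obtain ⟨D, hDpos, hD⟩ := exists_common_den c
  choose d hd using hD
  have hall : ∀ k', ∑ j, c j * (z j k' : ℚ) = 0 := by
    intro k'
    have := congr_fun hc k'
    simpa [Finset.sum_apply, Pi.smul_apply, smul_eq_mul] using this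
  have hdz : ∑ j, d j • z j = 0 := by
    ext k'
    simp only [Finset.sum_apply, Pi.smul_apply, smul_eq_mul, Pi.zero_apply]
    have h1 : ((∑ j, d j * z j k' : ℤ) : ℚ) = (D : ℚ) * ∑ j, c j * (z j k' : ℚ) := by
      push_cast
      rw [Finset.mul_sum]
      refine Finset.sum_congr rfl fun j _ => ?_
      rw [← hd j]
      ring
    rw [hall k', mul_zero] at h1
    exact_mod_cast h1
  have h0 := (Fintype.linearIndependent_iff.mp hz) d hdz i
  have hD0 : (D : ℚ) ≠ 0 := by exact_mod_cast hDpos.ne'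
  have : (D : ℚ) * c i = 0 := by rw [hd i, h0]; simp
  exact (mul_eq_zero.mp this).resolve_left hD0

/-- Row rank equals column rank: a matrix over a field with linearly independent rows has a non-singular
maximal column-submatrix. [folklore] -/
private theorem exists_submatrix_det_ne_zero {K : Type*} [Field K] {l k : ℕ} (B : Matrix (Fin l) (Fin k) K)
    (hB : LinearIndependent K B.row) :
    ∃ ν : Fin l → Fin k, Function.Injective ν ∧ (B.submatrix id ν).det ≠ 0 := by
  have hrank : Module.finrank K ↥(Submodule.span K (Set.range B.col)) = l := by
    rw [← Matrix.rank_eq_finrank_span_cols, hB.rank_matrix, Fintype.card_fin]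
  obtain ⟨κ, a, ha, hspan, hli⟩ := exists_linearIndependent' K B.col
  haveI : Finite κ := Finite.of_injective a ha
  letI : Fintype κ := Fintype.ofFinite κ
  have hcard : Fintype.card κ = l := by
    rw [linearIndependent_iff_card_eq_finrank_span.mp hli, Set.finrank, hspan, hrank]
  let e : Fin l ≃ κ := (Fintype.equivFinOfCardEq hcard).symm
  refine ⟨a ∘ e, ha.comp e.injective, ?_⟩
  have hcols : LinearIndependent K (B.submatrix id (a ∘ ⇑e)).col := hli.comp e e.injective
  have hU : IsUnit (B.submatrix id (a ∘ ⇑e)) := Matrix.linearIndependent_cols_iff_isUnit.mp hcols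
  rw [Matrix.isUnit_iff_isUnit_det, isUnit_iff_ne_zero] at hU
  exact hU

/-- **Theorem 2.3 holds** (the printed proof: `ω ε_n = −[ϖ | ω][q_n; p_n]` is an `l × (m+1)` matrix of rank `l`
— `[ϖ | ω]` has rank `l`, `[q_n; p_n]` is non-singular — so by the pigeonhole principle one `l × l`
column-submatrix `ν` is a non-singular INTEGER matrix for infinitely many `n`, whereas Binet–Cauchy and the minor
hypothesis send `det(ω ε_n^{(−,ν)})` to `0`). [cite: Marcovecchio2021, Theorem 2.3] -/
theorem theorem23_holds : theorem23 := by
  intro m l γ q p hl hlm hdet hnonsing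
  by_contra hlt
  rw [not_le] at hlt
  obtain ⟨z, hzli, hrel⟩ := exists_integer_relations γ hlt
  set ω : Matrix (Fin l) (Fin m) ℤ := Matrix.of fun i μ => z i μ.succ with hω
  have hωε := omega_mul_eps γ q p z hrel
  -- the integer matrices `[q_n; p_n]` and `Z = [ϖ | ω]`; `−ω ε_n = Z [q_n; p_n]`
  set QP : ℕ → Matrix (Fin (m + 1)) (Fin (m + 1)) ℤ :=
    fun n => Matrix.of (Fin.cons (q n) (p n) : Fin (m + 1) → Fin (m + 1) → ℤ) with hQP
  set Z : Matrix (Fin l) (Fin (m + 1)) ℤ := Matrix.of z with hZ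
  have hM : ∀ n, (Matrix.of fun i ν => -(z i 0 * q n ν + ∑ μ, z i μ.succ * p n μ ν) :
      Matrix (Fin l) (Fin (m + 1)) ℤ) = -(Z * QP n) := by
    intro n
    ext i ν
    simp [hZ, hQP, Matrix.mul_apply, Fin.sum_univ_succ]
  -- `Z [q_n; p_n]` has rank `l` (independent rows over `ℚ`) for every `n`
  have hrows : ∀ n, LinearIndependent ℚ ((Z * QP n).map (Int.cast : ℤ → ℚ)).row := by
    intro n
    have hZi : Function.Injective (Z.map (Int.cast : ℤ → ℚ)).vecMul := by
      rw [Matrix.vecMul_injective_iff]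
      exact linearIndependent_cast_rat z hzli
    have hPi : Function.Injective ((QP n).map (Int.cast : ℤ → ℚ)).vecMul := by
      refine Matrix.vecMul_injective_iff_isUnit.mpr ?_
      rw [Matrix.isUnit_iff_isUnit_det, ← Int.cast_det, isUnit_iff_ne_zero]
      exact_mod_cast hnonsing n
    rw [← Matrix.vecMul_injective_iff]
    have hmap : (Z * QP n).map (Int.cast : ℤ → ℚ) =
        Z.map (Int.cast : ℤ → ℚ) * (QP n).map (Int.cast : ℤ → ℚ) := by
      ext i j
      simp [Matrix.mul_apply]
    rw [hmap]
    intro c c' h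
    have h' : (c ᵥ* Z.map (Int.cast : ℤ → ℚ)) ᵥ* (QP n).map (Int.cast : ℤ → ℚ) =
        (c' ᵥ* Z.map (Int.cast : ℤ → ℚ)) ᵥ* (QP n).map (Int.cast : ℤ → ℚ) := by
      simpa only [Matrix.vecMul_vecMul] using h
    exact hZi (hPi h')
  -- for each `n` a non-singular `l × l` column-submatrix; by pigeonhole one choice `ν₀` serves infinitely often
  choose ν hν using fun n => exists_submatrix_det_ne_zero _ (hrows n)
  obtain ⟨ν₀, hinf⟩ := Finite.exists_infinite_fiber ν
  have hinfset : {n : ℕ | ν n = ν₀}.Infinite := by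
    have := Set.infinite_coe_iff.mp hinf
    simpa only [Set.preimage, Set.mem_singleton_iff] using this
  obtain ⟨n₀, hn₀⟩ := hinfset.nonempty
  have hν₀ : Function.Injective ν₀ := by
    have h := (hν n₀).1
    rwa [show ν n₀ = ν₀ from hn₀] at h
  -- Binet–Cauchy on the columns `ν₀`
  set E : ℕ → Matrix (Fin m) (Fin l) ℝ := fun n => (eps γ q p n).submatrix id ν₀ with hE
  have hElim : ∀ μ : Fin l → Fin m, Function.Injective μ →
      Tendsto (fun n => ((E n).submatrix μ id).det) atTop (𝓝 0) := by
    intro μ hμ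
    simpa only [hE, Matrix.submatrix_submatrix, Function.comp_id, Function.id_comp] using hdet μ ν₀ hμ hν₀
  have hlim := tendsto_det_mul (ω.map (Int.cast : ℤ → ℝ)) E hElim
  have hprod : ∀ n, ω.map (Int.cast : ℤ → ℝ) * E n =
      (-((Z * QP n).submatrix id ν₀)).map (Int.cast : ℤ → ℝ) := by
    intro n
    have h1 : ω.map (Int.cast : ℤ → ℝ) * E n =
        (ω.map (Int.cast : ℤ → ℝ) * eps γ q p n).submatrix id ν₀ := by
      ext i j
      simp [hE, Matrix.mul_apply]
    rw [h1, hω, hωε n, hM n, Matrix.submatrix_map]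
    rfl
  have hfreq : ∃ᶠ n in atTop, (1 : ℝ) ≤ |(ω.map (Int.cast : ℤ → ℝ) * E n).det| := by
    refine (Nat.frequently_atTop_iff_infinite.mpr hinfset).mono fun n hn => ?_
    have hn' : ν n = ν₀ := hn
    have hdetQ := (hν n).2
    rw [hn', Matrix.submatrix_map, ← Int.cast_det] at hdetQ
    have hdetZ : ((Z * QP n).submatrix id ν₀).det ≠ 0 := by exact_mod_cast hdetQ
    rw [hprod n, ← Int.cast_det, Matrix.det_neg]
    have h1 : (1 : ℤ) ≤ |((Z * QP n).submatrix id ν₀).det| := Int.one_le_abs hdetZ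
    have h2 : (1 : ℝ) ≤ |((((Z * QP n).submatrix id ν₀).det : ℤ) : ℝ)| := by exact_mod_cast h1
    simpa [abs_mul, abs_pow] using h2
  have hev : ∀ᶠ n in atTop, |(ω.map (Int.cast : ℤ → ℝ) * E n).det| < 1 :=
    (hlim.abs).eventually (gt_mem_nhds (by norm_num : |(0 : ℝ)| < 1))
  obtain ⟨n, hn1, hn2⟩ := (hfreq.and_eventually hev).exists
  linarith

end Literature.NumberTheory.DiophantineApproximation.Marcovecchio2021
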